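import Summits.BirchSwinnertonDyer.BirchSwinnertonDyer.Theorems.ClassRecordThreeCornerAtThreeTwinKatoRat
import Summits.BirchSwinnertonDyer.BirchSwinnertonDyer.Theorems.ErratumRoadFiveNonSurjCornerTwinKatoFacts

/-!
# Route `ClassRecordThree` (rung K2@3), crux 7 `CornerAtThree` (item 19111), conjunct (Tw)
# `Three.CornerTwistAt`: the twin's Kato half at `p = 3` BY NAME — six named Literature facts + `μ = 0`; conjunct
# (Tw) ⟸ [lower half at every odd Heegner twin] + [`μ = 0` at every such twin] modulo named facts
# (cell `bsd-stepL`, seat `bsd-stepL-corner-p1` g5; `--supports stmt-BirchSwinnertonDyer-19111`)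

Composition of `Theorems/ClassRecordThreeCornerAtThreeTwinKatoRat.lean` (p477889: the Kato half of a rank-`0` twin at
`3` from the prime-uniform binder `X5.O1.KatoMultiplicativeDivisibilityRat Wd 3`) with the `p = 2` cell's leaf
`MultKatoRat.katoMultiplicativeDivisibilityRat_of_facts_odd` (the binder at every ODD `p` from Kato's §17.13 inputs
at a multiplicative prime) through this seat's `multDivisibilityAt_of_katoFacts_of_corollary18_of_mu_eq_zero`
(`Theorems/ErratumRoadFiveNonSurjCornerTwinKatoFacts.lean`):

* §1 `missingUpperBoundAt_of_katoFacts_of_corollary18_of_mu_eq_zero` — at ANY globally minimal `W` of analytic rank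
  `0` with `p ≠ 2` multiplicative: the Kato half `Typed.MissingUpperBoundAt W p` from SIX NAMED facts
  (`Kato2004.nonempty_iwasawaH1Data`, `Kato2004.thm12_4`, `Kato2004.exists_multDivisibilityInputs_{nonsplit,split}`,
  `Greenberg1999.thm15_isTorsion_multiplicative_rat`, Wuthrich Cor. 18) + the rank-`0` engine's PUBLISHED inputs
  (SW13 Thm. 6.1 ×2, GZK, modularity ×2, Greenberg–Stevens) + ONE shape: `μ(X(E/ℚ_∞)) = 0`.
* §2 **`cornerTwistAt_of_lowerTwists_of_katoFacts_of_mu_eq_zero`** — conjunct (Tw) `Three.CornerTwistAt W` of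
  item 19111 ⟸ the six facts + engine pubs + [the main-conjecture half `MissingLowerBoundAt Wd 3` at every odd
  Heegner twin] + [`μ = 0` at every such twin]. The binder `hK` of p477889 §3 is GONE.

READING. On (T4″)@3 the twin summand (Tw) = the route's IMC side at the twin (`hlow`) + Greenberg's `μ = 0` at the
twin (rung K6's object at `3 ∥ N`), modulo named facts. Nothing else.

HONEST FRAMING. Theorems only (no `def`, no fact minted); CONDITIONAL on the named facts listed and on the shapes
`hlow`, `hμ`; nothing here proves them or any pair's `BSD(3)`; item 19111 does NOT close (conjuncts `CornerStepLAt`,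
`CornerUpperAt` untouched); no census word moves; BSD is not proved by any of this.

References: [Kato2004Asterisque] Thm. 12.4–12.6, 16.6, §17.13; [Rubin1998Durham] Prop. A.2; [Wuthrich2014] p. 394,
Cor. 18; [Kobayashi2006DocMath] Thm. 4.1; [GreenbergLNM1716] Thm. 1.5, Conj. 1.11; [SteinWuthrich2013] Thm. 6.1;
[Miller2011LMS] Def. 1.1; tree: `Kato2004/DivisibilityInputsMultiplicative.lean`,
`Theorems/ByReductionTypeAtTwoMultKatoRatOfInputs.lean` (bsd-2adic), this seat's `…TwinKatoRat.lean` ∕ `…TwinKatoFacts.lean`.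
-/

noncomputable section

open scoped Classical NumberField MatrixGroups ModularForm

namespace Summit.BirchSwinnertonDyer.Rank1Residual.X11b

open CongruenceSubgroup WeierstrassCurve NumberField IsDedekindDomain Field
  Literature.NumberTheory.EllipticCurves
  Literature.NumberTheory.EllipticCurves.ModularForms
  Literature.NumberTheory.EllipticCurves.Rank1Residual
  Literature.NumberTheory.EllipticCurves.Rank1Residual.Typed
  Literature.NumberTheory.EllipticCurves.Wuthrich2014
  Literature.NumberTheory.EllipticCurves.SteinWuthrich2013
  Literature.NumberTheory.EllipticCurves.Greenberg1999
  Summit.BirchSwinnertonDyer.Rank1Residual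
  Summit.BirchSwinnertonDyer.Rank1Residual.X11b.Three
  Summit.BirchSwinnertonDyer.BirchSwinnertonDyer.Theorems

/-! ### §1 The Kato half in analytic rank `0` at an odd multiplicative prime, BY NAME -/

/-- **The Kato half `Typed.MissingUpperBoundAt W p` of a rank-`0` pair at an odd multiplicative prime from NAMED
facts + `μ = 0`.** Facts: the rank-`0` engine's (SW13 Thm. 6.1 ×2 `hJs` `hJn`, GZK `hGZK`, modularity `hmod`
`hpar`, Greenberg–Stevens `hGS`) and the six of the Euler-system half (`hne`, `h12`, `hns`, `hsp`, `h15`, `h18`);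
shape: `hμ`. Chain: `multDivisibilityAt_of_katoFacts_of_corollary18_of_mu_eq_zero` then the engine
`missingUpperBoundAt_of_multDivisibilityAt_of_analyticRank_eq_zero` (p453738). NO image hypothesis, NO (ram), NO
Euler-unit certificate. [cite: SteinWuthrich2013, Thm. 6.1 (p. 20) and §4.2] [cite: Wuthrich2014, Cor. 18 (p. 398)]
[cite: Kato2004Asterisque, Thm. 17.4 (p. 273), §17.13 (pp. 279–280)] [cite: GreenbergLNM1716, Thm. 1.5 (PDF p. 61)]
[cite: Miller2011LMS, Def. 1.1] -/
theorem missingUpperBoundAt_of_katoFacts_of_corollary18_of_mu_eq_zero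
    (hJs : thm61_splitMultiplicative) (hJn : thm61_nonsplitMultiplicative)
    (hGZK : rank_eq_analyticRank_of_analyticRank_le_one) (hmod : hasEntireLFunction_rat)
    (hpar : nonempty_modularParametrizationData)
    (hne : Kato2004.nonempty_iwasawaH1Data) (h12 : Kato2004.thm12_4)
    (hns : Kato2004.exists_multDivisibilityInputs_nonsplit)
    (hsp : Kato2004.exists_multDivisibilityInputs_split)
    (h15 : thm15_isTorsion_multiplicative_rat)
    (h18 : Wuthrich2014.corollary18_padicLFunction_mem_iwasawaAlgebra_multiplicative)
    (W : WeierstrassCurve ℚ) [W.IsElliptic] [W.IsGloballyMinimal] (p : ℕ) [Fact p.Prime]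
    (hGS : greenberg_stevens (W := W) (p := p))
    (hp : p ≠ 2) (hmult : W.HasMultiplicativeReductionAtPrime p) (hr : W.analyticRank = 0)
    (hμ : ∀ (κ : ZpExtension ℚ p) (γ : Field.absoluteGaloisGroup ℚ),
      κ.IsCyclotomic → κ.IsTopGenerator γ → IsCyclotomicVariable p γ →
      ∀ D : W.SelmerDualData κ γ, D.mu = 0) :
    Typed.MissingUpperBoundAt W p :=
  missingUpperBoundAt_of_multDivisibilityAt_of_analyticRank_eq_zero hJs hJn hGZK hmod hpar W p hGS hp
    hmult hr
    (multDivisibilityAt_of_katoFacts_of_corollary18_of_mu_eq_zero hne h12 hns hsp h15 h18 W p hp hmult hμ)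

/-! ### §2 `p = 3`: conjunct (Tw) `Three.CornerTwistAt` of item 19111, BY NAME -/

/-- **Conjunct (Tw) `Three.CornerTwistAt W` of crux 7 `CornerAtThree` (item 19111) modulo NAMED facts + [the
main-conjecture half `MissingLowerBoundAt` at every odd Heegner twin] + [`μ = 0` at every such twin] — nothing
else.** p477889's `cornerTwistAt_of_lowerTwists_of_katoMultRat_of_mu_eq_zero` with its binder `hK` (the
prime-uniform Kato statement at each twin `(Wd, 3)`) DISCHARGED from the six named facts
(`MultKatoRat.katoMultiplicativeDivisibilityRat_of_facts_odd` at `p = 3`). CONDITIONAL on `hlow`, `hμ`; does NOT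
close item 19111 (conjuncts `CornerStepLAt`, `CornerUpperAt` untouched); nothing booked.
[cite: Kato2004Asterisque, Thm. 17.4 (p. 273), §17.13 (pp. 279–280)] [cite: Wuthrich2014, p. 394 and Cor. 18 (p. 398)]
[cite: GreenbergLNM1716, Thm. 1.5 (PDF p. 61); §1 Conj. 1.11 (shape of μ = 0)] [cite: SteinWuthrich2013, Thm. 6.1 (p. 20)]
[cite: Miller2011LMS, §1 and Def. 1.1] -/
theorem cornerTwistAt_of_lowerTwists_of_katoFacts_of_mu_eq_zero
    (hJs : thm61_splitMultiplicative) (hJn : thm61_nonsplitMultiplicative)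
    (hGZK : rank_eq_analyticRank_of_analyticRank_le_one) (hmod : hasEntireLFunction_rat)
    (hpar : nonempty_modularParametrizationData)
    (hGS : ∀ (W : WeierstrassCurve ℚ) [W.IsElliptic] [W.IsGloballyMinimal] (p : ℕ) [Fact p.Prime],
      greenberg_stevens (W := W) (p := p))
    (hne : Kato2004.nonempty_iwasawaH1Data) (h12 : Kato2004.thm12_4)
    (hns : Kato2004.exists_multDivisibilityInputs_nonsplit)
    (hsp : Kato2004.exists_multDivisibilityInputs_split)
    (h15 : thm15_isTorsion_multiplicative_rat)
    (h18 : Wuthrich2014.corollary18_padicLFunction_mem_iwasawaAlgebra_multiplicative)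
    (W : WeierstrassCurve ℚ) [W.IsElliptic] [W.IsGloballyMinimal]
    -- the main-conjecture ∕ Eisenstein half at every odd Heegner twin (route cruxes at the twin; shape)
    (hlow : ∀ (K : Type) [Field K] [NumberField K]
      (Wd : WeierstrassCurve ℚ) [Wd.IsElliptic] [Wd.IsGloballyMinimal] (Cd : VariableChange ℚ),
      ClassX11b W 3 → ¬ Surj W 3 → IsImaginaryQuadratic K → Odd (NumberField.discr K) →
      SatisfiesHeegnerHypothesis (W.conductorNorm ℤ) K →
      (W.quadraticTwist (NumberField.discr K : ℚ)).entireLFunction 1 ≠ 0 →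
      Cd • W.quadraticTwist (NumberField.discr K : ℚ) = Wd → Typed.MissingLowerBoundAt Wd 3)
    -- Greenberg's μ = 0 at every such twin (rung K6's object; shape) — the ONLY other twin input left
    (hμ : ∀ (K : Type) [Field K] [NumberField K]
      (Wd : WeierstrassCurve ℚ) [Wd.IsElliptic] [Wd.IsGloballyMinimal] (Cd : VariableChange ℚ),
      ClassX11b W 3 → ¬ Surj W 3 → IsImaginaryQuadratic K → Odd (NumberField.discr K) →
      SatisfiesHeegnerHypothesis (W.conductorNorm ℤ) K →
      (W.quadraticTwist (NumberField.discr K : ℚ)).entireLFunction 1 ≠ 0 →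
      Cd • W.quadraticTwist (NumberField.discr K : ℚ) = Wd →
      ∀ (κ : ZpExtension ℚ 3) (γ : Field.absoluteGaloisGroup ℚ),
        κ.IsCyclotomic → κ.IsTopGenerator γ → IsCyclotomicVariable 3 γ →
        ∀ D : Wd.SelmerDualData κ γ, D.mu = 0) :
    CornerTwistAt W :=
  cornerTwistAt_of_lowerTwists_of_katoMultRat_of_mu_eq_zero hJs hJn hGZK hmod hpar hGS h18 W hlow
    (fun _K _ _ Wd _ _ _Cd _ _ _ _ _ _ _ ↦
      MultKatoRat.katoMultiplicativeDivisibilityRat_of_facts_odd Wd 3 (by decide) hne h12 hns hsp h15)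
    hμ

end Summit.BirchSwinnertonDyer.Rank1Residual.X11b

end
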